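import Summits.BirchSwinnertonDyer.BirchSwinnertonDyer.Theorems.ClassRecordThreeCornerAtThreeUpperShimuraInertSavingOfTwinLowerD
import Summits.BirchSwinnertonDyer.BirchSwinnertonDyer.Theorems.ClassRecordThreeCornerAtThreeUpperShimuraSavedDDefs
import Summits.BirchSwinnertonDyer.BirchSwinnertonDyer.Theorems.ClassRecordThreeCornerAtThreeTwinLowerSupplyDefs
import Summits.BirchSwinnertonDyer.Rank1Residual.X11b.BDPRouteTamagawaSupport
import HarnessLib

/-!
# Route `ErratumRoadFive` (K2, `p ≥ 5`), crux `EulerHalfNotRamNoInertSetAtFive` (item stmt-BirchSwinnertonDyer-19715), line `birth`: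
# the residual S2b CUT BY «INERT SET ADMISSIBLE UP TO ONE OFFENDING CARRIER» — the Euler-system half from the SAVED inert display
# (cell `bsd-stepL`, lead seat `bsd-line-er5-p1` g0; `--supports stmt-BirchSwinnertonDyer-19715 --as helper`)

WHAT. Line `birth` (v5 of record, RULING 53) cuts crux 19715 — X11b ∧ `p ≥ 5` ∧ `ρ̄` onto ∧ ¬(ram) ∧ `p ∣ ∏c` pairs with NO admissible inert set —
by datum: split-set datum → the landed road; `p` the only multiplicative prime → S1b (closed modulo print + `X11aLowerHalf`, p615583); otherwise S2b
(`stub_res_otherMultNoSplitDatumAtFive`; ONE census pair below `5·10⁵`: (129360cy1, 5), `N = 2⁴·3·5·7²·11`, multiplicative primes `{3, 5, 11}` ALL split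
carriers with `5 ∣ ord_ℓ Δ_min` — every even `S ⊂ {3,5,11}` leaves exactly ONE offending carrier outside `S`). THIS FILE is the road for that shape at a
general `p ≥ 5`: an even multiplicative `S ∋ p` carrying every offending split carrier EXCEPT ONE `q₁ ∉ S`, with a Papikian–Rabinoff half `R ⊆ S` of primes
`q ≠ 2`, `p ∤ q − 1` — «admissible up to one» —, GIVEN the SAVED inert display at `(W, p, q₁)` (`Theorems.ShimuraInertSavedDisplayAtD W p q₁`: Gross–Zagier on
`X_{N⁺,N⁻}` with `p ∈ S` inert, the degree link, and Kolyvagin's order bound SHARPENED by Jetchev's Tamagawa saving at the one N⁺-carrier `q₁`,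
`ord_p #Ш(E∕K)[p^∞] + 2·ord_p c_{q₁}(E) ≤ 2·ord_p [E(K):ℤP]`, on frames with `d_K < −4`). It is corner-p1's corner road
`NonSurjCorner.missingUpperBoundAt_of_admissibleUpToOne_of_savedDisplayD_of_twinLower` (whose `¬ Surj`∕`p ∈ {5,7}` binders serve only `5 ≤ p`) read for
EVERY X11b ∧ ¬(ram) pair at `p ≥ 5` — one call to the cell's generic core `missingUpperBoundAt_of_classX11b_of_inertSet_of_extraPlace_odd_of_twinLowerD`
(tam3-p1 ∕ corner-p1; image-free, (ram)-free) with the twin-lower supply from Friedberg–Hoffstein + the X11a lower half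
(`fhTwinLowerSupplyAt_of_friedbergHoffstein_of_x11aLowerHalf`).
* `missingUpperBoundAt_of_classX11b_of_not_ram_of_upToOne_of_savedDisplayD` — pair level.
* `res_otherMultUpToOneAtFive_of_savedDisplayD_of_lowerX11a` — class level, the skeleton's S2b′ shape: hypotheses = the `PublishedInputsFive` conjuncts
  hGZK hmod hnf hFH(inert) hMaz, the route items `ShimuraParametrizationDataNonempty` (hJL) and `PastenComponentOrdersInput` (hCO), Barrios et al.'s printed
  `c₂` fact (`localTamagawaNumber_quadraticTwist_two_mem_of_goodReduction`, hBR), `X11aLowerHalf` as a ∀-statement, and ONE displayed binder `hSavD` — the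
  saved display at every X11b ∧ `p ≥ 5` ∧ surj ∧ ¬(ram) pair and every OFFENDING split carrier `q₁` (`p ∣ ord_{q₁} Δ_min`).
At (129360cy1, 5): `S = {3, 5}`, `R = {3}` (`5 ∤ 2`), `q₁ = 11`. What is then left of S2b is the shape «≥ 2 offending carriers outside EVERY admissible S»
(0 census pairs below `5·10⁵`; barrier `StringentKolyvaginCapsAtMax`: Jetchev's saving is a max, not a product).

HONEST FRAMING: THEOREMS ONLY, Theses-free, no `sorry`, no definition, no new named fact; CONDITIONAL on every displayed binder — `hSavD` is an OPEN typed
object (conjecture-tagged `Theorems.ShimuraInertSavedDisplayAtD`; at `p ∈ S` its D-form is produced p-generically by lane B corner3-p2 g9's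
`ShimuraKolyvaginOfImage.savedOrderBound_of_labels_ofImage` modulo the labelled CM family with (B6), Poitou–Tate and Cassels–Tate — not invoked here),
`X11aLowerHalf` is the OPEN crux 19064, hBR ∕ hJL ∕ hCO ∕ the FH and Mazur facts are printed; nothing is booked; 19715 is NOT closed; BSD is proved for no
curve; no summit statement is touched. Credit: corner-p1 (the corner road, g13–g16), tam3-p1 (inert saving core), shim-p1, -w2.
-- adapted from Summits/BirchSwinnertonDyer/BirchSwinnertonDyer/Theorems/ErratumRoadFiveNonSurjCornerSavedDisplayDOfLabelsB6.lean (§2)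
References (locators only): [cite: Jetchev2008, Thm. 1.1, (1), Cor. 1.5 (p. 812)] [cite: Kim2022HigherGZ, §2.1, Thm. 4.3, Rem. 7.9] [cite: CaiShuTian2014, Thm. 1.5]
[cite: PastenShimura2024, §6.6, Lemmas 6.15, 6.16, 6.18] [cite: PapikianRabinoff2016, Cor. 3.5] [cite: RibetTakahashi1997, Thms. 1–2]
[cite: BarriosEtAl2025, c₂ of quadratic twists at good 2] [cite: McCallumLMS1991, Cor. 5.6].
-/

set_option autoImplicit false
set_option linter.dupNamespace false

noncomputable section

open scoped Classical NumberField

open WeierstrassCurve NumberField IsDedekindDomain Field Literature.NumberTheory.EllipticCurves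
  Literature.NumberTheory.EllipticCurves.BarriosEtAl2025
  Literature.NumberTheory.EllipticCurves.ModularForms Literature.NumberTheory.EllipticCurves.Rank1Residual
  Literature.NumberTheory.EllipticCurves.Rank1Residual.Typed Literature.NumberTheory.Automorphic
  Summit.BirchSwinnertonDyer.Rank1Residual Summit.BirchSwinnertonDyer.Rank1Residual.X11b

namespace Summit.BirchSwinnertonDyer.BirchSwinnertonDyer.Theorems.EulerHalfInertUpToOne

/-! ### §1 Pair level -/

/-- **X11b ∧ `p ≥ 5` ∧ ¬(ram), inert set admissible UP TO ONE offending split carrier `q₁`, SAVED display at `q₁` ⟹ the Euler-system half.**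
Corner-p1's `NonSurjCorner.missingUpperBoundAt_of_admissibleUpToOne_of_savedDisplayD_of_twinLower` for every image (its `¬ Surj` ∕ `p ∈ {5,7}`
binders only fed `5 ≤ p`): one call to `missingUpperBoundAt_of_classX11b_of_inertSet_of_extraPlace_odd_of_twinLowerD` with the Tamagawa shape off
`q₁` from `p ≥ 5` and the twin-lower supply from Friedberg–Hoffstein + the X11a lower half. CONDITIONAL on hSavD (open typed object), hX11a (open
crux) and the printed inputs. [cite: Jetchev2008, Thm. 1.1, Cor. 1.5] [cite: Kim2022HigherGZ, Rem. 7.9] [cite: PastenShimura2024, Lemma 6.18] -/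
theorem missingUpperBoundAt_of_classX11b_of_not_ram_of_upToOne_of_savedDisplayD
    (hGZK : rank_eq_analyticRank_of_analyticRank_le_one) (hmod : hasEntireLFunction_rat)
    (hnf : exists_isNewformOf) (hFH : friedbergHoffstein_exists_twist_ne_zero_inertAt)
    (hMaz : mazur_not_dvd_maninConstant_of_odd)
    (hBR : localTamagawaNumber_quadraticTwist_two_mem_of_goodReduction)
    (hJL : nonempty_shimuraParametrizationData)
    (hCO : PastenShimura2024_componentOrders)
    (W : WeierstrassCurve ℚ) [W.IsElliptic] [W.IsGloballyMinimal] (p : ℕ) [Fact p.Prime]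
    (hX : ClassX11b W p) (hp5 : 5 ≤ p) (hnram : ¬ Ram W p)
    (hX11a : ∀ (Wd : WeierstrassCurve ℚ) [Wd.IsElliptic] [Wd.IsGloballyMinimal],
      ClassX11a Wd p → Typed.MissingLowerBoundAt Wd p)
    (q₁ : ℕ) [Fact q₁.Prime] (hq₁ : W.HasSplitMultiplicativeReductionAtPrime q₁)
    (hSavD : Theorems.ShimuraInertSavedDisplayAtD W p q₁)
    (hdat : ∃ S : Finset ℕ, (∀ ℓ ∈ S, ∃ _ : Fact ℓ.Prime, Mult W ℓ) ∧ Even S.card ∧ p ∈ S ∧ q₁ ∉ S ∧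
      (∀ (ℓ : ℕ) [Fact ℓ.Prime], ℓ ∉ S → ℓ ≠ q₁ → W.HasSplitMultiplicativeReductionAtPrime ℓ →
        ¬ p ∣ padicValInt ℓ W.minimalDiscriminantInt) ∧
      ∃ R ⊆ S, S.card = 2 * R.card ∧ ∀ q ∈ R, q ≠ 2 ∧ ¬ p ∣ q - 1) :
    Typed.MissingUpperBoundAt W p := by
  obtain ⟨S, hSmult, hSeven, hpS, hq₁S, hFC, hdeg⟩ := hdat
  have hbad₁ : ¬ W.HasGoodReductionAtPrime q₁ :=
    WeierstrassCurve.HasMultiplicativeReduction.not_hasGoodReduction (R := ℤ_[q₁]) hq₁.hasMultiplicativeReductionAtPrime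
  have hshape : ∀ (q : ℕ) [Fact q.Prime], q ≠ q₁ → p ∣ (W.baseChange ℚ_[q]).localTamagawaNumber ℤ_[q] →
      W.HasSplitMultiplicativeReductionAtPrime q := by
    intro q _ _ hdvd
    haveI : (W.baseChange ℚ_[q]).IsElliptic := inferInstanceAs (W.map (algebraMap ℚ ℚ_[q])).IsElliptic
    exact hasSplitMultiplicativeReduction_of_five_le_of_dvd_localTamagawaNumber q (W.baseChange ℚ_[q]) hp5 hdvd
  exact Theorems.missingUpperBoundAt_of_classX11b_of_inertSet_of_extraPlace_odd_of_twinLowerD hGZK hmod hnf hMaz hBR hJL hCO W p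
    hX q₁ hbad₁ hshape hSavD (Theorems.fhTwinLowerSupplyAt_of_friedbergHoffstein_of_x11aLowerHalf hGZK hmod hnf hFH W p hX hnram hX11a)
    S hSmult hSeven hpS hq₁S (fun ℓ _ hℓS hℓq hs ↦ hFC ℓ hℓS hℓq hs) (Or.inr hdeg)

/-! ### §2 Class level: the skeleton's S2b′ shape -/

/-- **S2b′ of line `birth` — the residual «p not the only multiplicative prime» ON THE UP-TO-ONE LOCUS:** for every X11b ∧ `p ≥ 5` ∧ `ρ̄` onto ∧
¬(ram) pair carrying an offending split carrier `q₁` and an inert set `S ∋ p`, `q₁ ∉ S`, admissible off `q₁` with a Papikian–Rabinoff half of primes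
`q ≠ 2`, `p ∤ q − 1`: `Typed.MissingUpperBoundAt W p` — GIVEN the published inputs, Barrios et al.'s `c₂` fact, the X11a lower half (∀) and the SAVED
inert display at every such pair and offending carrier (`hSavD`, the ONE non-print binder). CONDITIONAL; nothing booked; covers the census pair
(129360cy1, 5) with `S = {3,5}`, `R = {3}`, `q₁ = 11`. [cite: Jetchev2008, Cor. 1.5] [cite: Kim2022HigherGZ, Rem. 7.9] [cite: PastenShimura2024, §6.6] -/
theorem res_otherMultUpToOneAtFive_of_savedDisplayD_of_lowerX11a
    (hGZK : rank_eq_analyticRank_of_analyticRank_le_one) (hmod : hasEntireLFunction_rat)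
    (hnf : exists_isNewformOf) (hFH : friedbergHoffstein_exists_twist_ne_zero_inertAt)
    (hMaz : mazur_not_dvd_maninConstant_of_odd)
    (hBR : localTamagawaNumber_quadraticTwist_two_mem_of_goodReduction)
    (hJL : nonempty_shimuraParametrizationData)
    (hCO : PastenShimura2024_componentOrders)
    (hX11a : ∀ (Wd : WeierstrassCurve ℚ) [Wd.IsElliptic] [Wd.IsGloballyMinimal] (p : ℕ) [Fact p.Prime],
      ClassX11a Wd p → Typed.MissingLowerBoundAt Wd p)
    (hSavD : ∀ (W : WeierstrassCurve ℚ) [W.IsElliptic] [W.IsGloballyMinimal] (p : ℕ) [Fact p.Prime]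
      (q₁ : ℕ) [Fact q₁.Prime], ClassX11b W p → 5 ≤ p → Surj W p → ¬ Ram W p →
      W.HasSplitMultiplicativeReductionAtPrime q₁ → p ∣ padicValInt q₁ W.minimalDiscriminantInt →
      Theorems.ShimuraInertSavedDisplayAtD W p q₁) :
    ∀ (W : WeierstrassCurve ℚ) [W.IsElliptic] [W.IsGloballyMinimal] (p : ℕ) [Fact p.Prime],
      ClassX11b W p → 5 ≤ p → Surj W p → ¬ Ram W p →
      (∃ (q₁ : ℕ) (_ : Fact q₁.Prime) (S : Finset ℕ), W.HasSplitMultiplicativeReductionAtPrime q₁ ∧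
        p ∣ padicValInt q₁ W.minimalDiscriminantInt ∧
        (∀ ℓ ∈ S, ∃ _ : Fact ℓ.Prime, Mult W ℓ) ∧ Even S.card ∧ p ∈ S ∧ q₁ ∉ S ∧
        (∀ (ℓ : ℕ) [Fact ℓ.Prime], ℓ ∉ S → ℓ ≠ q₁ → W.HasSplitMultiplicativeReductionAtPrime ℓ →
          ¬ p ∣ padicValInt ℓ W.minimalDiscriminantInt) ∧
        ∃ R ⊆ S, S.card = 2 * R.card ∧ ∀ q ∈ R, q ≠ 2 ∧ ¬ p ∣ q - 1) →
      Typed.MissingUpperBoundAt W p := by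
  intro W _ _ p _ hX hp5 hsurj hnram hdat
  obtain ⟨q₁, _, S, hq₁, hoff, hSmult, hSeven, hpS, hq₁S, hFC, hdeg⟩ := hdat
  exact missingUpperBoundAt_of_classX11b_of_not_ram_of_upToOne_of_savedDisplayD hGZK hmod hnf hFH hMaz hBR hJL hCO W p hX hp5
    hnram (fun Wd _ _ hXa ↦ hX11a Wd p hXa) q₁ hq₁ (hSavD W p q₁ hX hp5 hsurj hnram hq₁ hoff)
    ⟨S, hSmult, hSeven, hpS, hq₁S, hFC, hdeg⟩

end Summit.BirchSwinnertonDyer.BirchSwinnertonDyer.Theorems.EulerHalfInertUpToOne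

end
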